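import Literature.Analysis.FluidPDE.PassiveScalarWeightedFlux
import Literature.Analysis.FluidPDE.PassiveScalarSpectralBounds
import Literature.Analysis.FunctionSpaces.KantorovichTransportPairing
import Literature.Analysis.FunctionSpaces.SobolevCommutatorL1
import Literature.Analysis.FunctionSpaces.TorusLipschitzGradient
import HarnessLib

/-!
# The slice lower bound for the evolution of the logarithmic Kantorovich distance

Analysis/FluidPDE proof-support file (everything proved). This is the Eulerian, mollified form
of the key estimate in the proof of Seis 2022, Lemma 3 (p. 7–8): the pairing of the flux
`G(s,·)` of the mollified equation (kernel `k_ε`) with a Kantorovich potential `ζ` that is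
optimal for a *frozen* profile `A₀` (think `A₀ = Ã(t₀) = θ(t₀) ⋆ k_ε`) is bounded below,

  `∫ ζ(x) G(s,x) dx ≥ -( C_d ‖A₀‖₂ ‖∇u(s)‖₂ + δ⁻¹ ‖u(s)‖₂ sup|Ã(s) - A₀|`
  `                     + δ⁻¹ √d ε ‖θ(s)‖₂ ‖∇u(s)‖₂ + κ δ⁻¹ ‖∇θ(s)‖₂ )`

(`Torus.integral_mul_flux_ge`), by writing `∫ ζ G = ∫ ⟪V, ∇ζ⟫ + κ ∫ θ Δ(ζ ⋆ k_ε)`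
(`PassiveScalarWeightedFlux`), splitting the mollified momentum
`V = A₀ u + (Ã(s) - A₀) u + [(θu) ⋆ k_ε - (θ ⋆ k_ε) u]` and using, respectively, the transport
pairing bound (`KantorovichTransportPairing`, the maximal-function argument of Seis' proof), the
trivial bound `|∇ζ| ≤ δ⁻¹`, the DiPerna–Lions commutator estimate (`SobolevCommutatorL1`), and the
`Ḣ¹ × Ḣ¹` pairing for the diffusion (`PassiveScalarSpectralBounds`, `|∇(ζ ⋆ k_ε)| ≤ δ⁻¹`).

Also: Lipschitz continuity of `krLogDist` in `L¹` (`Torus.krLogDist_le_krLogDist_add`,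
`Torus.abs_krLogDist_sub_le`).

## References

* C. Seis, Comm. Math. Phys. 2022 (arXiv:2003.08794), Lemma 3 and its proof, pp. 7–8. [`Seis2022`]
* R. J. DiPerna, P.-L. Lions, Invent. Math. 98 (1989), Lemma II.1. [`DiPernaLions1989`]
-/

noncomputable section

open MeasureTheory TopologicalSpace Set Function Filter Topology Metric UnitAddTorus
open scoped ENNReal NNReal Convolution ContDiff InnerProductSpace

namespace Literature.Analysis.FluidPDE

namespace Torus

open Literature.MeasureTheory.OptimalTransport FunctionSpaces.Torus

variable {d : Type*} [Fintype d] [DecidableEq d]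

/-! ## `krLogDist` is Lipschitz in `L¹` -/

omit [DecidableEq d] in
/-- **`krLogDist` is `L¹`-Lipschitz** on mean-zero integrable functions:
`krLogDist δ θ ≤ krLogDist δ θ' + log(1 + 1/(2δ)) ∫ |θ - θ'|`. [folklore] -/
theorem krLogDist_le_krLogDist_add {δ : ℝ} (hδ : 0 < δ) {θ θ' : UnitAddTorus d → ℝ}
    (hθ : Integrable θ volume) (hθ' : Integrable θ' volume) (h0 : ∫ x, θ x = 0) (h0' : ∫ x, θ' x = 0) :
    krLogDist δ θ ≤ krLogDist δ θ' + Real.log (1 + 1 / (2 * δ)) * ∫ x, |θ x - θ' x| := by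
  haveI : Nonempty {ζ : UnitAddTorus d → ℝ // IsLogLipschitz δ ζ} := nonempty_isLogLipschitz hδ
  refine ciSup_le fun ζ => ?_
  have hζ : IsLogLipschitz δ (ζ : UnitAddTorus d → ℝ) := ζ.2
  have hsub : Integrable (fun x => θ x - θ' x) volume := hθ.sub hθ'
  have h0s : ∫ x, (θ x - θ' x) = 0 := by rw [integral_sub hθ hθ', h0, h0', sub_zero]
  have e : ∫ x, θ x * (ζ : UnitAddTorus d → ℝ) x =
      (∫ x, θ' x * (ζ : UnitAddTorus d → ℝ) x) + ∫ x, (θ x - θ' x) * (ζ : UnitAddTorus d → ℝ) x := by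
    rw [← integral_add (hζ.integrable_mul hδ hθ') (hζ.integrable_mul hδ hsub)]
    exact integral_congr_ae (Eventually.of_forall fun x => by ring)
  rw [e]
  exact add_le_add (integral_mul_le_krLogDist hδ hθ' h0' hζ)
    (integral_mul_le_log_mul_integral_abs hδ hsub h0s hζ)

omit [DecidableEq d] in
/-- `|krLogDist δ θ - krLogDist δ θ'| ≤ log(1 + 1/(2δ)) ∫ |θ - θ'|` for mean-zero integrable
`θ, θ'`. [folklore] -/
theorem abs_krLogDist_sub_le {δ : ℝ} (hδ : 0 < δ) {θ θ' : UnitAddTorus d → ℝ}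
    (hθ : Integrable θ volume) (hθ' : Integrable θ' volume) (h0 : ∫ x, θ x = 0) (h0' : ∫ x, θ' x = 0) :
    |krLogDist δ θ - krLogDist δ θ'| ≤ Real.log (1 + 1 / (2 * δ)) * ∫ x, |θ x - θ' x| := by
  rw [abs_le]
  constructor
  · have h := krLogDist_le_krLogDist_add hδ hθ' hθ h0' h0
    have e : ∫ x, |θ' x - θ x| = ∫ x, |θ x - θ' x| := integral_congr_ae (Eventually.of_forall fun x => abs_sub_comm _ _)
    rw [e] at h
    linarith
  · have h := krLogDist_le_krLogDist_add hδ hθ hθ' h0 h0'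
    linarith

/-! ## From `ℝ≥0∞` bounds to real bounds -/

omit [Fintype d] [DecidableEq d] in
/-- `‖r‖ₑ ≤ b < ∞` gives `|r| ≤ b.toReal`. [folklore] -/
theorem _root_.Literature.Analysis.FluidPDE.abs_le_toReal_of_enorm_le {r : ℝ} {b : ℝ≥0∞} (h : ‖r‖ₑ ≤ b)
    (hb : b ≠ ⊤) : |r| ≤ b.toReal := by
  rw [Real.enorm_eq_ofReal_abs] at h
  exact (ENNReal.ofReal_le_iff_le_toReal hb).1 h

omit [DecidableEq d] in
/-- `|∫ ⟪c, ∇ζ⟫| ≤ L (∫⁻ ‖c‖ₑ).toReal` when `‖∇ζ‖ ≤ L` and `c` has finite `L¹` size. [folklore] -/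
theorem abs_integral_inner_gradient_le {c : UnitAddTorus d → EuclideanSpace ℝ d} {ζ : UnitAddTorus d → ℝ}
    {L : ℝ} (hL : ∀ x, ‖FunctionSpaces.Torus.gradient ζ x‖ ≤ L) (hc : AEStronglyMeasurable c volume)
    (hfin : ∫⁻ x, ‖c x‖ₑ < ⊤) :
    |∫ x, ⟪c x, FunctionSpaces.Torus.gradient ζ x⟫_ℝ| ≤ L * (∫⁻ x, ‖c x‖ₑ).toReal := by
  have hL0 : 0 ≤ L := (norm_nonneg _).trans (hL 0)
  have hci : Integrable c volume := ⟨hc, hfin⟩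
  rw [← integral_norm_eq_lintegral_enorm hc, ← MeasureTheory.integral_const_mul, ← Real.norm_eq_abs]
  refine norm_integral_le_of_norm_le (hci.norm.const_mul L) (Eventually.of_forall fun x => ?_)
  rw [Real.norm_eq_abs]
  calc |⟪c x, FunctionSpaces.Torus.gradient ζ x⟫_ℝ| ≤ ‖c x‖ * ‖FunctionSpaces.Torus.gradient ζ x‖ := abs_real_inner_le_norm _ _
    _ ≤ ‖c x‖ * L := mul_le_mul_of_nonneg_left (hL x) (norm_nonneg _)
    _ = L * ‖c x‖ := mul_comm _ _

/-! ## The slice lower bound -/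

section Slice

variable {θs A₀ ζ : UnitAddTorus d → ℝ} {v : UnitAddTorus d → EuclideanSpace ℝ d}
  {π : Measure (UnitAddTorus d × UnitAddTorus d)} {δ ε κ w : ℝ} {G M : ℝ≥0}

/-- **The slice lower bound** (Seis 2022, proof of Lemma 3, mollified Eulerian form). Data: an
`L²` slice `θs` with finite spectral gradient norm, an `L²` drift `v` with `‖∇v‖²_{L²} ≤ G`,
`‖v‖²_{L²} ≤ M`, a continuous frozen profile `A₀` with an optimal pair `(π, ζ)` for `D_δ(A₀)`
(`ζ` log-Lipschitz, `∇ζ(x) = ∇ζ(y)` and `|∇ζ(x)| ≤ (δ + |x-y|)⁻¹` `π`-a.e.), and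
`sup|θs ⋆ k_ε - A₀| ≤ w`. Then the flux of the mollified equation paired with `ζ` satisfies
`∫ ζ G ≥ -(C_d ‖A₀‖₂ √G + δ⁻¹ √M w + δ⁻¹ √d ε ‖θs‖₂ √G + κ δ⁻¹ ‖∇θs‖₂)`.
[cite: Seis2022, Lemma 3 (proof, pp. 7–8)] -/
theorem integral_mul_flux_ge (hδ : 0 < δ) (hε : 0 < ε) (hε' : ε ≤ 1 / 4) (hκ : 0 ≤ κ)
    (hθs : MemLp θs 2 volume) (hE : eScalarGradNormSq θs ≠ ⊤)
    (hv : MemLp v 2 volume) (hvG : eGradNormSq v ≤ G) (hvM : ∫⁻ x, ‖v x‖ₑ ^ 2 ≤ M)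
    (hA₀ : Continuous A₀) (hπ : IsCoupling (posMeasure A₀) (negMeasure A₀) π) (hζ : IsLogLipschitz δ ζ)
    (hae : ∀ᵐ z ∂π, FunctionSpaces.Torus.gradient ζ z.1 = FunctionSpaces.Torus.gradient ζ z.2 ∧ ‖FunctionSpaces.Torus.gradient ζ z.1‖ ≤ (δ + dist z.1 z.2)⁻¹)
    (hw : ∀ x, |(θs ⋆ kernel ε) x - A₀ x| ≤ w) :
    -(ENNReal.toReal (pairingConst d) * (eLpNorm A₀ 2 volume).toReal * Real.sqrt G +
        δ⁻¹ * Real.sqrt M * w +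
        δ⁻¹ * (Real.sqrt (Fintype.card d) * ε) * (eLpNorm θs 2 volume).toReal * Real.sqrt G +
        κ * δ⁻¹ * (eScalarGradNormSq θs ^ (1 / 2 : ℝ)).toReal) ≤
      ∫ x, ζ x * ∫ y, θs y * (-⟪v y, FunctionSpaces.Torus.gradient (kernel ε) (x - y)⟫_ℝ + κ * FunctionSpaces.Torus.laplacian (kernel ε) (x - y)) := by
  -- basic facts
  have hθi : Integrable θs volume := hθs.integrable one_le_two
  have hvi : Integrable v volume := hv.integrable one_le_two
  have hvθ : Integrable (fun y => ‖v y‖ * θs y) volume := by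
    have h1 := (integrable_smul_of_memLp_two hθs hv).norm
    refine h1.mono' (hv.1.norm.mul hθs.1) (Eventually.of_forall fun y => ?_)
    rw [norm_mul, norm_norm, Real.norm_eq_abs, norm_smul, Real.norm_eq_abs]
    exact (mul_comm _ _).le
  have hK : LipschitzWith (Real.toNNReal δ⁻¹) ζ := hζ.lipschitzWith hδ
  have hgradζ : ∀ x, ‖FunctionSpaces.Torus.gradient ζ x‖ ≤ δ⁻¹ := hζ.norm_gradient_le_inv hδ
  have hk := isSmooth_kernel (d := d) hε hε'
  obtain ⟨Ck, hCk⟩ := exists_forall_norm_le_of_continuous hk.continuous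
  have hw0 : 0 ≤ w := (abs_nonneg _).trans (hw 0)
  -- the flux identity
  rw [integral_mul_flux_eq hθi hv.1 hvθ hK hε hε' κ]
  -- ### the transport part
  set V : UnitAddTorus d → EuclideanSpace ℝ d := fun x => ∫ y, (θs y * kernel ε (x - y)) • v y with hV
  set As : UnitAddTorus d → ℝ := θs ⋆ kernel ε with hAs
  have hAsc : Continuous As := continuous_convolution hθi hk.continuous
  set comm : UnitAddTorus d → EuclideanSpace ℝ d := fun x => V x - As x • v x with hcomm
  have hsplitV : ∀ x, V x = A₀ x • v x + ((As x - A₀ x) • v x + comm x) := fun x => by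
    simp only [hcomm, sub_smul]; abel
  -- integrability of the three pairings
  obtain ⟨CA, hCA⟩ := exists_forall_norm_le_of_continuous hA₀
  obtain ⟨CAs, hCAs⟩ := exists_forall_norm_le_of_continuous hAsc
  have hgm : AEStronglyMeasurable (FunctionSpaces.Torus.gradient ζ) volume := (measurable_gradient ζ).aestronglyMeasurable
  have hint_smul : ∀ {a : UnitAddTorus d → ℝ} (ha : Continuous a) {Ca : ℝ} (hCa : ∀ x, ‖a x‖ ≤ Ca),
      Integrable (fun x => ⟪a x • v x, FunctionSpaces.Torus.gradient ζ x⟫_ℝ) volume := by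
    intro a ha Ca hCa
    refine Integrable.mono' (hvi.norm.const_mul (Ca * δ⁻¹))
      ((ha.aestronglyMeasurable.smul hv.1).inner hgm) (Eventually.of_forall fun x => ?_)
    rw [Real.norm_eq_abs]
    have hCa0 : 0 ≤ Ca := (norm_nonneg _).trans (hCa x)
    calc |⟪a x • v x, FunctionSpaces.Torus.gradient ζ x⟫_ℝ| ≤ ‖a x • v x‖ * ‖FunctionSpaces.Torus.gradient ζ x‖ := abs_real_inner_le_norm _ _
      _ ≤ (Ca * ‖v x‖) * δ⁻¹ := by
          rw [norm_smul]
          exact mul_le_mul (mul_le_mul_of_nonneg_right (hCa x) (norm_nonneg _)) (hgradζ x) (norm_nonneg _)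
            (by positivity)
      _ = Ca * δ⁻¹ * ‖v x‖ := by ring
  have hI1 : Integrable (fun x => ⟪A₀ x • v x, FunctionSpaces.Torus.gradient ζ x⟫_ℝ) volume := hint_smul hA₀ hCA
  have hI2 : Integrable (fun x => ⟪(As x - A₀ x) • v x, FunctionSpaces.Torus.gradient ζ x⟫_ℝ) volume :=
    hint_smul (hAsc.sub hA₀) (Ca := CAs + CA) fun x => (norm_sub_le _ _).trans (add_le_add (hCAs x) (hCA x))
  -- the commutator is integrable (finite `L¹` size, measurable)
  have hcomm_m : AEStronglyMeasurable comm volume := by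
    have hVm : AEStronglyMeasurable V volume := by
      have hF : AEStronglyMeasurable (Function.uncurry fun (x y : UnitAddTorus d) => (θs y * kernel ε (x - y)) • v y)
          ((volume : Measure (UnitAddTorus d)).prod volume) :=
        ((hθs.1.comp_snd).mul ((hk.continuous.comp (continuous_fst.sub continuous_snd)).aestronglyMeasurable)).smul
          hv.1.comp_snd
      exact hF.integral_prod_right'
    exact hVm.sub (hAsc.aestronglyMeasurable.smul hv.1)
  have hcomm_fin : ∫⁻ x, ‖comm x‖ₑ < ⊤ := by
    refine (lintegral_enorm_mollifyCommutator_le hθs hv hε hε').trans_lt ?_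
    refine ENNReal.mul_lt_top (ENNReal.mul_lt_top ENNReal.ofReal_lt_top hθs.eLpNorm_lt_top) ?_
    exact ENNReal.rpow_lt_top_of_nonneg (by norm_num) (ne_top_of_le_ne_top ENNReal.coe_ne_top hvG)
  have hI3 : Integrable (fun x => ⟪comm x, FunctionSpaces.Torus.gradient ζ x⟫_ℝ) volume := by
    refine Integrable.mono' ((Integrable.norm ⟨hcomm_m, hcomm_fin⟩).mul_const δ⁻¹) (hcomm_m.inner hgm)
      (Eventually.of_forall fun x => ?_)
    rw [Real.norm_eq_abs]
    exact (abs_real_inner_le_norm _ _).trans (mul_le_mul_of_nonneg_left (hgradζ x) (norm_nonneg _))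
  have hsplitI : ∫ x, ⟪V x, FunctionSpaces.Torus.gradient ζ x⟫_ℝ = (∫ x, ⟪A₀ x • v x, FunctionSpaces.Torus.gradient ζ x⟫_ℝ) +
      ((∫ x, ⟪(As x - A₀ x) • v x, FunctionSpaces.Torus.gradient ζ x⟫_ℝ) + ∫ x, ⟪comm x, FunctionSpaces.Torus.gradient ζ x⟫_ℝ) := by
    have e1 : ∫ x, ⟪V x, FunctionSpaces.Torus.gradient ζ x⟫_ℝ = ∫ x, (⟪A₀ x • v x, FunctionSpaces.Torus.gradient ζ x⟫_ℝ +
        (⟪(As x - A₀ x) • v x, FunctionSpaces.Torus.gradient ζ x⟫_ℝ + ⟪comm x, FunctionSpaces.Torus.gradient ζ x⟫_ℝ)) :=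
      integral_congr_ae (Eventually.of_forall fun x => by dsimp only; rw [hsplitV x, inner_add_left, inner_add_left])
    have e2 : ∫ x, (⟪A₀ x • v x, FunctionSpaces.Torus.gradient ζ x⟫_ℝ +
        (⟪(As x - A₀ x) • v x, FunctionSpaces.Torus.gradient ζ x⟫_ℝ + ⟪comm x, FunctionSpaces.Torus.gradient ζ x⟫_ℝ)) =
        (∫ x, ⟪A₀ x • v x, FunctionSpaces.Torus.gradient ζ x⟫_ℝ) +
          ∫ x, (⟪(As x - A₀ x) • v x, FunctionSpaces.Torus.gradient ζ x⟫_ℝ + ⟪comm x, FunctionSpaces.Torus.gradient ζ x⟫_ℝ) :=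
      integral_add hI1 (hI2.add hI3)
    have e3 : ∫ x, (⟪(As x - A₀ x) • v x, FunctionSpaces.Torus.gradient ζ x⟫_ℝ + ⟪comm x, FunctionSpaces.Torus.gradient ζ x⟫_ℝ) =
        (∫ x, ⟪(As x - A₀ x) • v x, FunctionSpaces.Torus.gradient ζ x⟫_ℝ) + ∫ x, ⟪comm x, FunctionSpaces.Torus.gradient ζ x⟫_ℝ :=
      integral_add hI2 hI3
    rw [e1, e2, e3]
  -- (I) the transport pairing bound for the frozen profile
  have hA₀2 : MemLp A₀ 2 volume := by
    exact (memLp_top_of_bound hA₀.aestronglyMeasurable CA (Eventually.of_forall hCA)).mono_exponent le_top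
  have hB1 : |∫ x, ⟪A₀ x • v x, FunctionSpaces.Torus.gradient ζ x⟫_ℝ| ≤
      ENNReal.toReal (pairingConst d) * (eLpNorm A₀ 2 volume).toReal * Real.sqrt G := by
    have h1 := enorm_integral_mul_inner_gradient_le hA₀2 hδ hπ hζ hae hv
    have e : (fun x => A₀ x * ⟪v x, FunctionSpaces.Torus.gradient ζ x⟫_ℝ) = fun x => ⟪A₀ x • v x, FunctionSpaces.Torus.gradient ζ x⟫_ℝ := by
      funext x; rw [real_inner_smul_left]
    rw [e] at h1
    have h2 : ‖∫ x, ⟪A₀ x • v x, FunctionSpaces.Torus.gradient ζ x⟫_ℝ‖ₑ ≤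
        pairingConst d * eLpNorm A₀ 2 volume * ((G : ℝ≥0∞) ^ (1 / 2 : ℝ)) :=
      h1.trans (mul_le_mul' le_rfl (ENNReal.rpow_le_rpow hvG (by norm_num)))
    have hfin : pairingConst d * eLpNorm A₀ 2 volume * ((G : ℝ≥0∞) ^ (1 / 2 : ℝ)) ≠ ⊤ :=
      ENNReal.mul_ne_top (ENNReal.mul_ne_top pairingConst_ne_top hA₀2.eLpNorm_ne_top)
        (ENNReal.rpow_ne_top_of_nonneg (by norm_num) ENNReal.coe_ne_top)
    refine (abs_le_toReal_of_enorm_le h2 hfin).trans (le_of_eq ?_)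
    rw [ENNReal.toReal_mul, ENNReal.toReal_mul, ← ENNReal.toReal_rpow, ENNReal.coe_toReal, Real.sqrt_eq_rpow]
  -- (II) the time-lag term
  have hvL1 : ∫ x, ‖v x‖ ≤ Real.sqrt M := by
    have h1 : ∫⁻ x, ‖v x‖ₑ ≤ (M : ℝ≥0∞) ^ (1 / 2 : ℝ) := by
      calc ∫⁻ x, ‖v x‖ₑ = eLpNorm v 1 volume := by rw [eLpNorm_one_eq_lintegral_enorm]
        _ ≤ eLpNorm v 2 volume := by
            have := eLpNorm_le_eLpNorm_mul_rpow_measure_univ (p := 1) (q := 2) (by norm_num) hv.1 (μ := volume)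
            simpa [measure_univ] using this
        _ = (∫⁻ x, ‖v x‖ₑ ^ 2) ^ (1 / 2 : ℝ) := by
            rw [eLpNorm_eq_lintegral_rpow_enorm_toReal two_ne_zero ENNReal.ofNat_ne_top, ENNReal.toReal_ofNat]
            congr 1
            exact lintegral_congr fun x => (ENNReal.rpow_two _)
        _ ≤ (M : ℝ≥0∞) ^ (1 / 2 : ℝ) := ENNReal.rpow_le_rpow hvM (by norm_num)
    rw [integral_norm_eq_lintegral_enorm hv.1]
    have hfin : (M : ℝ≥0∞) ^ (1 / 2 : ℝ) ≠ ⊤ := ENNReal.rpow_ne_top_of_nonneg (by norm_num) ENNReal.coe_ne_top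
    refine (ENNReal.toReal_mono hfin h1).trans (le_of_eq ?_)
    rw [← ENNReal.toReal_rpow, ENNReal.coe_toReal, Real.sqrt_eq_rpow]
  have hB2 : |∫ x, ⟪(As x - A₀ x) • v x, FunctionSpaces.Torus.gradient ζ x⟫_ℝ| ≤ δ⁻¹ * Real.sqrt M * w := by
    rw [← Real.norm_eq_abs]
    refine (norm_integral_le_of_norm_le (hvi.norm.const_mul (w * δ⁻¹)) (Eventually.of_forall fun x => ?_)).trans ?_
    · rw [Real.norm_eq_abs]
      calc |⟪(As x - A₀ x) • v x, FunctionSpaces.Torus.gradient ζ x⟫_ℝ|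
          ≤ ‖(As x - A₀ x) • v x‖ * ‖FunctionSpaces.Torus.gradient ζ x‖ := abs_real_inner_le_norm _ _
        _ ≤ (w * ‖v x‖) * δ⁻¹ := by
            rw [norm_smul, Real.norm_eq_abs]
            exact mul_le_mul (mul_le_mul_of_nonneg_right (hw x) (norm_nonneg _)) (hgradζ x) (norm_nonneg _)
              (by positivity)
        _ = w * δ⁻¹ * ‖v x‖ := by ring
    · rw [MeasureTheory.integral_const_mul]
      calc w * δ⁻¹ * ∫ x, ‖v x‖ ≤ w * δ⁻¹ * Real.sqrt M := by gcongr
        _ = δ⁻¹ * Real.sqrt M * w := by ring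
  -- (III) the commutator
  have hB3 : |∫ x, ⟪comm x, FunctionSpaces.Torus.gradient ζ x⟫_ℝ| ≤
      δ⁻¹ * (Real.sqrt (Fintype.card d) * ε) * (eLpNorm θs 2 volume).toReal * Real.sqrt G := by
    refine (abs_integral_inner_gradient_le hgradζ hcomm_m hcomm_fin).trans ?_
    have h1 : ∫⁻ x, ‖comm x‖ₑ ≤ ENNReal.ofReal (Real.sqrt (Fintype.card d) * ε) * eLpNorm θs 2 volume *
        ((G : ℝ≥0∞) ^ (1 / 2 : ℝ)) :=
      (lintegral_enorm_mollifyCommutator_le hθs hv hε hε').trans (mul_le_mul' le_rfl (ENNReal.rpow_le_rpow hvG (by norm_num)))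
    have hfin : ENNReal.ofReal (Real.sqrt (Fintype.card d) * ε) * eLpNorm θs 2 volume * ((G : ℝ≥0∞) ^ (1 / 2 : ℝ)) ≠ ⊤ :=
      ENNReal.mul_ne_top (ENNReal.mul_ne_top ENNReal.ofReal_ne_top hθs.eLpNorm_ne_top)
        (ENNReal.rpow_ne_top_of_nonneg (by norm_num) ENNReal.coe_ne_top)
    have h2 := ENNReal.toReal_mono hfin h1
    rw [ENNReal.toReal_mul, ENNReal.toReal_mul, ENNReal.toReal_ofReal (by positivity), ← ENNReal.toReal_rpow,
      ENNReal.coe_toReal, ← Real.sqrt_eq_rpow] at h2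
    calc δ⁻¹ * (∫⁻ x, ‖comm x‖ₑ).toReal ≤ δ⁻¹ * (Real.sqrt (Fintype.card d) * ε * (eLpNorm θs 2 volume).toReal * Real.sqrt G) :=
          mul_le_mul_of_nonneg_left h2 (inv_nonneg.2 hδ.le)
      _ = _ := by ring
  -- ### the diffusion part
  have hζε : IsSmooth (ζ ⋆ kernel ε) := isSmooth_convolution (hζ.continuous hδ).integrable_unitAddTorus hk
  have hgradζε : ∀ x, ‖FunctionSpaces.Torus.gradient (ζ ⋆ kernel ε) x‖ ≤ δ⁻¹ := fun x => by
    have := norm_gradient_convolution_kernel_le hK hε hε' x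
    rwa [Real.coe_toNNReal _ (inv_nonneg.2 hδ.le)] at this
  have hB4 : |∫ y, θs y * FunctionSpaces.Torus.laplacian (ζ ⋆ kernel ε) y| ≤ δ⁻¹ * (eScalarGradNormSq θs ^ (1 / 2 : ℝ)).toReal := by
    have h1 := enorm_integral_mul_laplacian_le_of_norm_gradient_le hθs hζε hgradζε
    have hfin : ENNReal.ofReal δ⁻¹ * eScalarGradNormSq θs ^ (1 / 2 : ℝ) ≠ ⊤ :=
      ENNReal.mul_ne_top ENNReal.ofReal_ne_top (ENNReal.rpow_ne_top_of_nonneg (by norm_num) hE)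
    refine (abs_le_toReal_of_enorm_le h1 hfin).trans (le_of_eq ?_)
    rw [ENNReal.toReal_mul, ENNReal.toReal_ofReal (inv_nonneg.2 hδ.le)]
  -- ### assemble
  rw [hsplitI]
  have e1 := neg_abs_le (∫ x, ⟪A₀ x • v x, FunctionSpaces.Torus.gradient ζ x⟫_ℝ)
  have e2 := neg_abs_le (∫ x, ⟪(As x - A₀ x) • v x, FunctionSpaces.Torus.gradient ζ x⟫_ℝ)
  have e3 := neg_abs_le (∫ x, ⟪comm x, FunctionSpaces.Torus.gradient ζ x⟫_ℝ)
  have e4 := neg_abs_le (∫ y, θs y * FunctionSpaces.Torus.laplacian (ζ ⋆ kernel ε) y)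
  have e5 : -(κ * (δ⁻¹ * (eScalarGradNormSq θs ^ (1 / 2 : ℝ)).toReal)) ≤ κ * ∫ y, θs y * FunctionSpaces.Torus.laplacian (ζ ⋆ kernel ε) y := by
    have := mul_le_mul_of_nonneg_left (e4.trans' (neg_le_neg hB4)) hκ
    linarith
  nlinarith [hB1, hB2, hB3, e1, e2, e3, e5]

end Slice

end Torus

end Literature.Analysis.FluidPDE
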